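import Literature.AlgebraicGeometry.Motives.AbelianVarietyPoincarePerfectField
import Literature.AlgebraicGeometry.Motives.AbelianVarietyPoincareEquivariant
import Literature.AlgebraicGeometry.Motives.AbelianVarietyPoincareEquivariantPolynomial
import Literature.AlgebraicGeometry.Motives.AbelianVarietyImageRestrict
import HarnessLib

/-!
# Poincaré's complete reducibility theorem with operators over a perfect field

Assembly of `Motives/AbelianVarietyPoincarePerfectField` (a quasi-retraction of every abelian
subvariety over a perfect field, by Galois averaging), `…PoincareEquivariant` /
`…PoincareEquivariantPolynomial` (averaging a quasi-retraction into an EQUIVARIANT one — finite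
groups, resp. a CM order `ℤ[α] ⊆ R` through the separability idempotent of `ℤ[T]/(f)`),
`…PoincareSplitting` (the complement `Z = im (M • 𝟙 X - h ≫ i)` of a quasi-retraction) and
`…ImageRestrict` (the induced action on an image):

* `AbelianVariety.exists_equivariant_complement_of_fintype` — **finite group `G`**: over a perfect
  field, a `G`-stable abelian subvariety `i : Y ↪ X` (`ρ : G →* End X`, `ρ' : G →* End Y`,
  `i` equivariant) has a `G`-stable complement: an abelian variety `Z` with `G`-action
  `χ : G →* End Z`, an equivariant closed immersion `j : Z ↪ X`, `(i, j) : Y ⊞ Z ⟶ X` an isogeny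
  with an equivariant two-sided quasi-inverse `(h, t)` — Poincaré's complete reducibility theorem
  with `G`-action (Lange–Rodríguez Thm. 2.7.1 = Birkenhake–Lange Thm. 13.5.2, there over `ℂ` via a
  `G`-invariant polarization);
* `AbelianVariety.exists_equivariant_complement_of_generator` — **CM order**: the same for ring
  actions `φ : R →+* End X`, `ψ : R →+* End Y` of a commutative ring `R` generated up to isogeny
  by one element `α` (`m r ∈ ℤ[α]` for every `r`, some `m ≠ 0`) satisfying an integral polynomial
  `f` with `c_u f + c_v f' = D ≠ 0` — e.g. `R` an order of a number (CM) field: the complement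
  carries an `R`-action `χ : R →+* End Z` making `j`, `h`, `t` equivariant (the "isogeny factors
  with the `M_μ`-action" of CM theory; Mumford §19 Thm. 1 with operators).

Everything is proved; no definition, no named fact (D-0026).

## References

* H. Lange, R. E. Rodríguez, *Decomposition of Jacobians by Prym Varieties*, LNM 2310 (2022),
  Thm. 2.7.1 (held copy `book:lange2022-decomposition-jacobians-by-prym-varieties`, PDF p. 38).
  [LangeRodriguez2022]
* D. Mumford, *Abelian Varieties* (1970), §19 Thm. 1 and Cor. 1–2 (pp. 173–174).
  [MumfordAV1970]
* J. S. Milne, *Abelian Varieties* (1986), Prop. 12.1 (p. 122). [Milne1986AbelianVarieties]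
-/

noncomputable section

universe u v

open CategoryTheory CategoryTheory.Limits AlgebraicGeometry Polynomial

namespace Literature.AlgebraicGeometry.Motives

namespace AbelianVariety

variable {K : Type u} [Field K] [PerfectField K] {X Y : AbelianVariety K}

omit [PerfectField K] in
/-- Bookkeeping: from an equivariant quasi-retraction `h` of `i` with `i ≫ h = M • 𝟙 Y`, `M ≠ 0`,
the complement `Z = im (M • 𝟙 X - h ≫ i)` with its induced action and the equivariant
quasi-inverse pair. [cite: MumfordAV1970, §19 Thm. 1 and proof of Cor. 2 (pp. 173–174)] -/
private theorem exists_equivariant_complement_of_equivariant_quasiRetraction {R : Type v}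
    [Semiring R] (φ : R →+* End X) (ψ : R →+* End Y) {i : Y ⟶ X} {h : X ⟶ Y} {M : ℕ}
    (hi : ∀ r : R, i ≫ End.asHom (φ r) = End.asHom (ψ r) ≫ i) (hM : M ≠ 0)
    (hih : i ≫ h = M • 𝟙 Y) (hh : ∀ r : R, End.asHom (φ r) ≫ h = h ≫ End.asHom (ψ r)) :
    ∃ (Z : AbelianVariety K) (χ : R →+* End Z) (j : Z ⟶ X) (t : X ⟶ Z),
      IsClosedImmersion (Hom.toSchemeHom j) ∧ IsIsogeny (biprod.desc i j) ∧
      IsIsogeny (biprod.lift h t) ∧ Y.dim + Z.dim = X.dim ∧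
      biprod.lift h t ≫ biprod.desc i j = M • 𝟙 X ∧
      biprod.desc i j ≫ biprod.lift h t = M • 𝟙 (Y ⊞ Z) ∧
      (∀ r : R, End.asHom (χ r) ≫ j = j ≫ End.asHom (φ r)) ∧
      (∀ r : R, t ≫ End.asHom (χ r) = End.asHom (φ r) ≫ t) := by
  have hv : ∀ r : R, End.asHom (φ r) ≫ (M • 𝟙 X - h ≫ i) = (M • 𝟙 X - h ≫ i) ≫ End.asHom (φ r) :=
    fun r ↦ comp_complementEndo_of_equivariant M (hi r) (hh r)
  exact ⟨image (M • 𝟙 X - h ≫ i), imageAction (M • 𝟙 X - h ≫ i) φ φ hv, imageι _, toImage _,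
    inferInstance, isIsogeny_desc_of_quasiRetraction hM hih, isIsogeny_lift_of_quasiRetraction hM hih,
    dim_add_dim_image_of_quasiRetraction hM hih, lift_desc_eq_nsmul_of_quasiRetraction i h M,
    desc_lift_eq_nsmul_of_quasiRetraction hih, imageAction_ι _ φ φ hv, toImage_imageAction _ φ φ hv⟩

/-- **Poincaré's complete reducibility theorem with a finite group of operators, over a perfect
field.** Let a finite group `G` act on abelian varieties `X`, `Y` over a perfect field
(`ρ : G →* End X`, `ρ' : G →* End Y`) and let `i : Y ↪ X` be an equivariant abelian subvariety.
Then there are an abelian variety `Z` with `G`-action `χ`, an equivariant closed immersion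
`j : Z ↪ X`, an equivariant quasi-retraction `h` of `i` (`i ≫ h = M • 𝟙 Y`, `M ≠ 0`) and an
equivariant `t : X ⟶ Z` such that `(i, j) : Y ⊞ Z ⟶ X` and `(h, t) : X ⟶ Y ⊞ Z` are isogenies,
quasi-inverse to each other (`(h, t) ≫ (i, j) = M • 𝟙`, `(i, j) ≫ (h, t) = M • 𝟙`), and
`dim Y + dim Z = dim X`. [cite: LangeRodriguez2022, Thm. 2.7.1]
[cite: MumfordAV1970, §19 Thm. 1 (pp. 173–174)] -/
theorem exists_equivariant_complement_of_fintype {G : Type v} [Group G] [Fintype G]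
    (ρ : G →* End X) (ρ' : G →* End Y) (i : Y ⟶ X) [IsClosedImmersion (Hom.toSchemeHom i)]
    (hi : ∀ g : G, i ≫ End.asHom (ρ g) = End.asHom (ρ' g) ≫ i) :
    ∃ (h : X ⟶ Y) (M : ℕ) (Z : AbelianVariety K) (χ : G →* End Z) (j : Z ⟶ X) (t : X ⟶ Z),
      M ≠ 0 ∧ i ≫ h = M • 𝟙 Y ∧ (∀ g : G, End.asHom (ρ g) ≫ h = h ≫ End.asHom (ρ' g)) ∧
      IsClosedImmersion (Hom.toSchemeHom j) ∧ IsIsogeny (biprod.desc i j) ∧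
      IsIsogeny (biprod.lift h t) ∧ Y.dim + Z.dim = X.dim ∧
      biprod.lift h t ≫ biprod.desc i j = M • 𝟙 X ∧
      biprod.desc i j ≫ biprod.lift h t = M • 𝟙 (Y ⊞ Z) ∧
      (∀ g : G, End.asHom (χ g) ≫ j = j ≫ End.asHom (ρ g)) ∧
      (∀ g : G, t ≫ End.asHom (χ g) = End.asHom (ρ g) ≫ t) := by
  obtain ⟨h₀, N, hN, hih₀⟩ := exists_quasiRetraction_of_perfectField i
  obtain ⟨h, hih, hh⟩ := exists_equivariant_quasiRetraction_of_fintype ρ ρ' hi hih₀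
  have hM : Fintype.card G * N ≠ 0 := mul_ne_zero Fintype.card_ne_zero hN
  -- the induced action on the complement, through the monoid algebra-free route: restrict each `ρ g`
  have hv : ∀ g : G, End.asHom (ρ g) ≫ ((Fintype.card G * N) • 𝟙 X - h ≫ i) =
      ((Fintype.card G * N) • 𝟙 X - h ≫ i) ≫ End.asHom (ρ g) :=
    fun g ↦ comp_complementEndo_of_equivariant _ (hi g) (hh g)
  let v : X ⟶ X := (Fintype.card G * N) • 𝟙 X - h ≫ i
  let χ : G →* End (image v) :=
    { toFun := fun g ↦ imageRestrict v (End.asHom (ρ g)) (End.asHom (ρ g)) (hv g)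
      map_one' := by
        have e : imageRestrict v (End.asHom (ρ 1)) (End.asHom (ρ 1)) (hv 1) =
            imageRestrict v (𝟙 X) (𝟙 X) (by rw [Category.id_comp, Category.comp_id]) := by
          congr 1 <;> rw [map_one] <;> rfl
        exact e.trans (imageRestrict_id v)
      map_mul' := fun g g' ↦ by
        have e : imageRestrict v (End.asHom (ρ (g * g'))) (End.asHom (ρ (g * g'))) (hv (g * g')) =
            imageRestrict v (End.asHom (ρ g') ≫ End.asHom (ρ g)) (End.asHom (ρ g') ≫ End.asHom (ρ g))
              (by rw [Category.assoc, hv g, ← Category.assoc, hv g', Category.assoc]) := by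
          congr 1 <;> rw [map_mul] <;> rfl
        exact e.trans (imageRestrict_comp v _ _ _ _ (hv g') (hv g)) }
  exact ⟨h, Fintype.card G * N, image v, χ, imageι v, toImage v, hM, hih, hh, inferInstance,
    isIsogeny_desc_of_quasiRetraction hM hih, isIsogeny_lift_of_quasiRetraction hM hih,
    dim_add_dim_image_of_quasiRetraction hM hih, lift_desc_eq_nsmul_of_quasiRetraction i h _,
    desc_lift_eq_nsmul_of_quasiRetraction hih, fun g ↦ imageRestrict_ι v _ _ (hv g),
    fun g ↦ toImage_imageRestrict v _ _ (hv g)⟩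

/-- **Poincaré's complete reducibility theorem with complex multiplication by an order, over a
perfect field.** Let a commutative ring `R` act on abelian varieties `X`, `Y` over a perfect field
(`φ : R →+* End X`, `ψ : R →+* End Y`), let `i : Y ↪ X` be an `R`-equivariant abelian subvariety,
and suppose `R` is generated up to isogeny by one element `α` — every `r ∈ R` has `m r = p(α)`
for some integer `m ≠ 0` and `p ∈ ℤ[T]` — with `f(α) = 0` for an integral polynomial `f`
admitting a certificate `c_u f + c_v f' = D`, `D ≠ 0` (e.g. `R` an order of the number field
`ℚ(α)`, `f` the minimal polynomial of `α`, `D` a multiple of its discriminant). Then there are an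
abelian variety `Z` with `R`-action `χ : R →+* End Z`, an equivariant closed immersion
`j : Z ↪ X`, an equivariant quasi-retraction `h` of `i` (`i ≫ h = M • 𝟙 Y`, `M ≠ 0`) and an
equivariant `t : X ⟶ Z` with `(i, j)`, `(h, t)` mutually quasi-inverse isogenies and
`dim Y + dim Z = dim X` — the decomposition of an abelian variety with complex multiplication into
`R`-stable isogeny factors. [cite: MumfordAV1970, §19 Thm. 1 (pp. 173–174)]
[cite: Milne1986AbelianVarieties, Prop. 12.1 (p. 122)] -/
theorem exists_equivariant_complement_of_generator {R : Type v} [CommRing R]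
    (φ : R →+* End X) (ψ : R →+* End Y) (i : Y ⟶ X) [IsClosedImmersion (Hom.toSchemeHom i)]
    (hi : ∀ r : R, i ≫ End.asHom (φ r) = End.asHom (ψ r) ≫ i) (α : R) (f cu cv : ℤ[X]) (D : ℤ)
    (hD : D ≠ 0) (hf : aeval α f = 0) (hcert : cu * f + cv * derivative f = C D)
    (hgen : ∀ r : R, ∃ (m : ℕ) (p : ℤ[X]), m ≠ 0 ∧ (m : R) * r = aeval α p) :
    ∃ (h : X ⟶ Y) (M : ℕ) (Z : AbelianVariety K) (χ : R →+* End Z) (j : Z ⟶ X) (t : X ⟶ Z),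
      M ≠ 0 ∧ i ≫ h = M • 𝟙 Y ∧ (∀ r : R, End.asHom (φ r) ≫ h = h ≫ End.asHom (ψ r)) ∧
      IsClosedImmersion (Hom.toSchemeHom j) ∧ IsIsogeny (biprod.desc i j) ∧
      IsIsogeny (biprod.lift h t) ∧ Y.dim + Z.dim = X.dim ∧
      biprod.lift h t ≫ biprod.desc i j = M • 𝟙 X ∧
      biprod.desc i j ≫ biprod.lift h t = M • 𝟙 (Y ⊞ Z) ∧
      (∀ r : R, End.asHom (χ r) ≫ j = j ≫ End.asHom (φ r)) ∧
      (∀ r : R, t ≫ End.asHom (χ r) = End.asHom (φ r) ≫ t) := by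
  obtain ⟨h₀, N, hN, hih₀⟩ := exists_quasiRetraction_of_perfectField i
  -- `f(φ α) = 0`, `f(ψ α) = 0`
  have hfφ : aeval (φ α) f = 0 := by
    have e : φ (aeval α f) = aeval (φ α) f := by
      rw [aeval_def, aeval_def, Polynomial.hom_eval₂, RingHom.ext_int (φ.comp _) (algebraMap ℤ _)]
    rw [← e, hf, map_zero]
  have hfψ : aeval (ψ α) f = 0 := by
    have e : ψ (aeval α f) = aeval (ψ α) f := by
      rw [aeval_def, aeval_def, Polynomial.hom_eval₂, RingHom.ext_int (ψ.comp _) (algebraMap ℤ _)]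
    rw [← e, hf, map_zero]
  obtain ⟨h₁, hih₁, hh₁⟩ := exists_equivariant_quasiRetraction_of_aeval_eq_zero (φ α) (ψ α)
    (hi α) hih₀ f cu cv D hfφ hfψ hcert
  -- normalise the sign: `h = sign D • h₁`, `i ≫ h = (N |D|) • 𝟙`
  have hih : i ≫ (D.sign • h₁) = (N * D.natAbs) • 𝟙 Y := by
    rw [Preadditive.comp_zsmul, hih₁, smul_smul, ← natCast_zsmul, Nat.cast_mul,
      ← Int.sign_mul_self_eq_natAbs, mul_left_comm]
  have hM : N * D.natAbs ≠ 0 := mul_ne_zero hN (Int.natAbs_ne_zero.2 hD)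
  have hhα : End.asHom (φ α) ≫ (D.sign • h₁) = (D.sign • h₁) ≫ End.asHom (ψ α) := by
    rw [Preadditive.comp_zsmul, Preadditive.zsmul_comp, hh₁]
  have hh : ∀ r : R, End.asHom (φ r) ≫ (D.sign • h₁) = (D.sign • h₁) ≫ End.asHom (ψ r) :=
    comp_eq_comp_of_nsmul_generator φ ψ α hhα hgen
  obtain ⟨Z, χ, j, t, hj, hσ, hτ, hdim, h1, h2, hχj, hχt⟩ :=
    exists_equivariant_complement_of_equivariant_quasiRetraction φ ψ hi hM hih hh
  exact ⟨D.sign • h₁, N * D.natAbs, Z, χ, j, t, hM, hih, hh, hj, hσ, hτ, hdim, h1, h2, hχj, hχt⟩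

end AbelianVariety

end Literature.AlgebraicGeometry.Motives
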